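import Literature.MathematicalPhysics.QuantumFieldTheory.Balaban1983to89.B9SectBCodedChainC37Y
import Literature.MathematicalPhysics.QuantumFieldTheory.Balaban1983to89.B9Ineq347SiteReadingY

/-!
# `Balaban1983to89.B9SectBCodedChainGlob` — the (3.47) member of the coded-carrier chain: the augmented readings `KSC₂` (global member SILENT at
# products), the (3.47) frame `GlobFrame₂` over the coded carrier INHABITED, and `hout` with the global member RECOVERED at `W = U′U` from (3.42) there

T. Bałaban, *Propagators for lattice gauge theories in a background field*, Commun. Math. Phys. **99** (1985) 389–434
[`Balaban1985BackgroundPropagators`, "B9"], Theorem 3.4 p. 400, (3.42) p. 397, (3.47) p. 398 («consequences of the local ones (3.42) and Lemma 2.1»), p. 403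
l. 1–9; T. Bałaban, *Propagators and renormalization transformations for lattice gauge theories. II*, Commun. Math. Phys. **96** (1984) 223–250
[`Balaban1984PropagatorsII`, "[4]"], Lemma 2.1 p. 234, (2.45) p. 231.

statement-level skeleton of published theorems with citation tags; proofs where landed; nothing here is a claim about the Yang–Mills mass gap

WHY THIS FILE (pub-ymgap N06 row 13, seat dag-n06-c gen 8; LOCATED in the seat's (O4) analysis).  The letters-level Sect.-B frames write each member of the
family AT THE PRODUCT `U′U` from r06's majorants WITHOUT an `M`-threshold (`B9SectBGpStepAtLettersV2.GlobFrame₂.writeGlob`, …).  For the (3.47) member this is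
impossible over ANY honest reading: the global weighted sups need [4] Lemma 2.1, i.e. `M ≧ M(δ)`.  The root frame escapes this because the augmented readings
`B9SectBGpReadingsY.KSC` make the (3.42) member at products TAUTOLOGICAL (U-letters) and the conversion to the record happens in `hout` (which has thresholds).
THIS FILE applies the same discipline to (3.47): the readings `KSC₂` coincide with `KSC` except that the GLOBAL member is SILENT (`0`) at coded products and
multipliers; then (i) `GlobFrame₂.writeGlob` holds trivially, so the (3.47) frame over the coded carrier is INHABITED on every subfamily with sections
(`globFrame₂CodedOn`); (ii) in `hout` the record's (3.47) block at `W = U′U` is RECOVERED from the record's converted (3.42) block at `W`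
(`B9SectBGpTransferConvY.hconv_at`) by `B9Ineq347SiteReadingY.globBlock_kernelFamilyS_of_eBlock` (print's sentence p. 398, at the threshold `Mg(δ₀/2)`);
(iii) the chain composes for `KSC₂` exactly as for `KSC` (`B9SectBCodedChainOnSubfamily`, `B9SectBCodedChainC37Y`).

WHAT IS IN THE FILE (0 sorry; standard axioms; `def`s = `KSC₂` and the two frames).
* §1 `KSC₂`, member lemmas, `thms_KSC₂_base_iff` (at a base the two readings have the same blocks), `thms_KSC_prod_of_KSC₂` (at a product, `KSC`'s block from
  `KSC₂`'s block plus the record's (3.47) block at `W`).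
* §2 `read342Y_KSC₂`, `write342Y_KSC₂` (the root frame's dictionaries, inherited), `globBlock_KSC₂_prod` (the silent member), ★ `globFrame₂CodedOn` — THE (3.47)
  FRAME OVER THE CODED CARRIERS OF A SUBFAMILY, INHABITED (extends the root frame `gpFrame₂CodedOn` at `KC := KSC₂`).
* §3 ★ `hin_KSC₂_on`, ★★ `hout_KSC₂_on` (threshold `max Mo Mg`, constant `max B₀ (B″·Cg)`), ★★ `sectBStepPrinted_on_of_KSC₂`, ★★ `sectBStepPrinted_on_of_KSC₂_C37Y`,
  ★★ `sectBStepPrinted_cornerFree_of_KSC₂_C37Y`.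

HONEST SCOPE.  One member of (O4) moved: with `KSC₂` the root AND the (3.47) frames over the coded carrier are inhabited; the Hölder ∕ (3.44)–(3.45) ∕ L² ∕ kernel ∕
analyticity frames remain (same discipline: augmented readings at products + conversions in `hout`, not in this file).  The displayed hypotheses of §3's
compositions are the frames' output for `KSC₂`, `hAn`, structural record data.  Nothing of Theorem 3.1∕3.4 asserted; N06 NOT discharged; COUNT-NEUTRAL; one
finite lattice programme — nothing continuum ∕ OS ∕ mass-gap ∕ Clay.  Cell `pub-ymgap` (HUMAN RULING D-0062), Track A node N06 [B9], row 13, 2026-08-28.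
-/

namespace Literature.MathematicalPhysics.QuantumFieldTheory.Balaban1983to89.B9SectBCodedChainGlob

open Literature.MathematicalPhysics.QuantumFieldTheory.Balaban1983to89
open Literature.MathematicalPhysics.QuantumFieldTheory.Balaban1983to89.B6KLevelCensusIndexV1 (KIdx kGeo)
open Literature.MathematicalPhysics.QuantumFieldTheory.Balaban1983to89.B6Ineq2142KLevelV1 (β)
open Literature.MathematicalPhysics.QuantumFieldTheory.Balaban1983to89.B6RandomWalk (HasMajorant)
open Literature.MathematicalPhysics.QuantumFieldTheory.Balaban1983to89.B9Thm34Ext (toB6)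
open Literature.MathematicalPhysics.QuantumFieldTheory.Balaban1983to89.B9FromB6 (EBlock GlobBlock)
open Literature.MathematicalPhysics.QuantumFieldTheory.Balaban1983to89.B9Eq39Adjoint (fluct)
open Literature.MathematicalPhysics.QuantumFieldTheory.Balaban1983to89.B9Eq352DivFormLetters (conj)
open Literature.MathematicalPhysics.QuantumFieldTheory.Balaban1983to89.B9Eq352GradLetters (diffLetter)
open Literature.MathematicalPhysics.QuantumFieldTheory.Balaban1983to89.B9SectBCodedCarrier (CCfg Coding pullK pullS pullAn sectBStepPrinted_of_coded)
open Literature.MathematicalPhysics.QuantumFieldTheory.Balaban1983to89.B9SectBStepFamilyTransfer (sectBStepPrinted_of_family)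
open Literature.MathematicalPhysics.QuantumFieldTheory.Balaban1983to89.B9SectBGpStepAtLettersV2 (GpFrame₂ GlobFrame₂)
open Literature.MathematicalPhysics.QuantumFieldTheory.Balaban1983to89.B9Eq360DeltaPrimeAY (AfldY mulY)
open Literature.MathematicalPhysics.QuantumFieldTheory.Balaban1983to89.B9PinMembersKLevelV1 (MemberY geo9Y bg9Y)
open Literature.MathematicalPhysics.QuantumFieldTheory.Balaban1983to89.B9SectBGpLettersY
open Literature.MathematicalPhysics.QuantumFieldTheory.Balaban1983to89.B9SectBGpFrameCodedY (codingYx CplxLettersY Read342Y Write342Y)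
open Literature.MathematicalPhysics.QuantumFieldTheory.Balaban1983to89.B9SectBGpReadingsY (KSC read342Y_KSC write342Y_KSC)
open Literature.MathematicalPhysics.QuantumFieldTheory.Balaban1983to89.B9SectBGpTransferOutY (thms_pullK_prod_of_KSC ineq342_346_347_weaken)
open Literature.MathematicalPhysics.QuantumFieldTheory.Balaban1983to89.B9SectBCodedClassY (C37Y cplxLettersY_of_C37Y)
open Literature.MathematicalPhysics.QuantumFieldTheory.Balaban1983to89.B9SectBCodedChainOnSubfamily (gpFrame₂CodedOn hin_KSC_on hconv_KSC_on)
open Literature.MathematicalPhysics.QuantumFieldTheory.Balaban1983to89.B9SectBCodedChainC37Y (hclass_C37Y_on)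
open Literature.MathematicalPhysics.QuantumFieldTheory.Balaban1983to89.B9Ineq347SiteReadingY (globBlock_kernelFamilyS_of_eBlock)
open Literature.MathematicalPhysics.QuantumFieldTheory.Balaban1983to89.B9GeoNormsKLevelV1 (geo9K_wNorm_nonneg)
open Literature.MathematicalPhysics.QuantumFieldTheory.Balaban1983to89.Node00 (SiteY BlkY IBondY CfgY SiteParY parSymY deltaPrimeAY kernelFamilyS GpY)

variable {d ℓ : ℕ} {hd : 1 ≤ d + 1} {hL : Odd (ℓ + 1) ∧ 1 < ℓ + 1} {b₀ b₁ : ℝ} {Mstar : ℕ}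
variable {𝔸 : Type} [NormedRing 𝔸] [NormedAlgebra ℂ 𝔸] [CompleteSpace 𝔸] [FiniteDimensional ℝ 𝔸]

/-! ## §1 The augmented readings with the global member silent at products -/

section KSC2

variable (G : Subgroup 𝔸ˣ) (x : MemberY d ℓ hd hL b₀ b₁ Mstar) (par : SiteParY 𝔸 x.toKIdx)
  (C37 C38 : ℝ → CfgY 𝔸 x.toKIdx → AfldY 𝔸 x.toKIdx → Prop)

/-- **THE AUGMENTED CODED READINGS WITH THE GLOBAL MEMBER SILENT AT PRODUCTS**: `KSC` (the record's readings at the decoded configuration, the (3.42) member at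
products in U-letters) with the (3.47) member replaced by `0` at coded multipliers and products (kept at bases).  The record's (3.47) at `W = U′U` is NOT read
here; it is recovered in `hout` from (3.42) at `W`. [cite: Balaban1985BackgroundPropagators, (3.47) p.398 («consequences of the local ones (3.42) and Lemma 2.1»), Thm 3.4 p.400] -/
noncomputable def KSC₂ : B9.KernelFamily (geo9Y x) (codingYx G x C37 C38).bg :=
  { KSC G x par C37 C38 with
    glob := fun n c lam γ => match c with
      | .base U => (KSC G x par C37 C38).glob n (.base U) lam γ
      | .mult _ => 0
      | .prod _ _ => 0 }

omit [FiniteDimensional ℝ 𝔸] in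
/-- the (3.42)–(3.46) members of `KSC₂` are `KSC`'s. [cite: Balaban1985BackgroundPropagators, (3.42)–(3.46) pp.397–398, bookkeeping] -/
theorem KSC₂_members :
    (KSC₂ G x par C37 C38).e = (KSC G x par C37 C38).e ∧ (KSC₂ G x par C37 C38).h1 = (KSC G x par C37 C38).h1 ∧
    (KSC₂ G x par C37 C38).e4 = (KSC G x par C37 C38).e4 ∧ (KSC₂ G x par C37 C38).h2 = (KSC G x par C37 C38).h2 ∧
    (KSC₂ G x par C37 C38).l2 = (KSC G x par C37 C38).l2 := ⟨rfl, rfl, rfl, rfl, rfl⟩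

omit [FiniteDimensional ℝ 𝔸] in
/-- the global member of `KSC₂` at a base is `KSC`'s (the record's at `U`). [cite: Balaban1985BackgroundPropagators, (3.47) p.398, bookkeeping] -/
theorem KSC₂_glob_base (n : Fin 4) (U : CfgY 𝔸 x.toKIdx) (lam : (geo9Y x).Loc) (γ : ℝ) :
    (KSC₂ G x par C37 C38).glob n (.base U) lam γ = (KSC G x par C37 C38).glob n (.base U) lam γ := rfl

omit [FiniteDimensional ℝ 𝔸] in
/-- the global member of `KSC₂` at a product is silent. [cite: Balaban1985BackgroundPropagators, (3.47) p.398, bookkeeping] -/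
theorem KSC₂_glob_prod (n : Fin 4) (U : CfgY 𝔸 x.toKIdx) (a : AfldY 𝔸 x.toKIdx) (lam : (geo9Y x).Loc) (γ : ℝ) :
    (KSC₂ G x par C37 C38).glob n (.prod U a) lam γ = 0 := rfl

omit [FiniteDimensional ℝ 𝔸] in
/-- **AT A BASE THE TWO READINGS HAVE THE SAME Theorem-3.1–3.3 BLOCK.** [cite: Balaban1985BackgroundPropagators, Thms 3.1–3.3 pp.397–399, bookkeeping] -/
theorem thms_KSC₂_base_iff (dC : ℕ) (GA : B9.KernelFamily (geo9Y x) (codingYx G x C37 C38).bg) (Cinv : B9.SiteKernel (geo9Y x) (codingYx G x C37 C38).bg)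
    (B₀ δ₀ : ℝ) (Bβ Bε : ℝ → ℝ) (Bεβ : ℝ → ℝ → ℝ) (B₁ δ₁ : ℝ) (U : CfgY 𝔸 x.toKIdx) :
    B9.Thms31to33IneqAt dC (KSC₂ G x par C37 C38) GA Cinv B₀ δ₀ Bβ Bε Bεβ B₁ δ₁ (.base U) ↔
      B9.Thms31to33IneqAt dC (KSC G x par C37 C38) GA Cinv B₀ δ₀ Bβ Bε Bεβ B₁ δ₁ (.base U) := Iff.rfl

omit [FiniteDimensional ℝ 𝔸] in
/-- **AT A PRODUCT, `KSC`'s BLOCK FROM `KSC₂`'s BLOCK AND THE RECORD's (3.47) BLOCK AT `W = e^{ηa}·U`** (constant `max B₀ B_g`).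
[cite: Balaban1985BackgroundPropagators, (3.47) p.398, Thms 3.1–3.3 pp.397–399, bookkeeping] -/
theorem thms_KSC_prod_of_KSC₂ (dC : ℕ) (GA : B9.KernelFamily (geo9Y x) (codingYx G x C37 C38).bg) (Cinv : B9.SiteKernel (geo9Y x) (codingYx G x C37 C38).bg)
    {B₀ δ₀ : ℝ} {Bβ Bε : ℝ → ℝ} {Bεβ : ℝ → ℝ → ℝ} {B₁ δ₁ : ℝ} {U : CfgY 𝔸 x.toKIdx} {a : AfldY 𝔸 x.toKIdx} (hB₀ : 0 ≤ B₀)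
    (h : B9.Thms31to33IneqAt dC (KSC₂ G x par C37 C38) GA Cinv B₀ δ₀ Bβ Bε Bεβ B₁ δ₁ (.prod U a)) {Bg : ℝ}
    (hglob : GlobBlock (kernelFamilyS x.toKIdx (bg9Y 𝔸 G x) (fun U => U) (GpY x.toKIdx par) par) Bg (mulY x.toKIdx (fluct (kGeo x.toKIdx).eta a) U)) :
    B9.Thms31to33IneqAt dC (KSC G x par C37 C38) GA Cinv (max B₀ Bg) δ₀ Bβ Bε Bεβ B₁ δ₁ (.prod U a) := by
  obtain ⟨⟨h42, h43⟩, hC, ⟨g42, g43⟩⟩ := h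
  have hw := ineq342_346_347_weaken G x C37 C38 (KSC₂ G x par C37 C38) hB₀ (le_max_left B₀ Bg) le_rfl h42
  refine ⟨⟨⟨hw.1, hw.2.1, fun n lam γ h1 h2 => ?_⟩, h43⟩, hC, ineq342_346_347_weaken G x C37 C38 GA hB₀ (le_max_left _ _) le_rfl g42, g43⟩
  exact (hglob n lam γ h1 h2).trans (mul_le_mul_of_nonneg_right (le_max_right _ _) (geo9K_wNorm_nonneg x.toKIdx γ lam))

end KSC2

/-! ## §2 The root dictionaries inherited, the silent global member, and ★ the (3.47) frame over the coded carriers of a subfamily -/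

section Frames

variable [NormOneClass 𝔸] {J : Type} (f : J → MemberY d ℓ hd hL b₀ b₁ Mstar)
  (c35 : ℝ) (G : Subgroup 𝔸ˣ) {ι : Type} [Fintype ι] [DecidableEq ι] (b : Module.Basis ι ℝ 𝔸)
  [∀ x : MemberY d ℓ hd hL b₀ b₁ Mstar, Fintype (geo9Y x).Site] [instDS : ∀ x : MemberY d ℓ hd hL b₀ b₁ Mstar, DecidableEq (geo9Y x).Site]
  [∀ x : MemberY d ℓ hd hL b₀ b₁ Mstar, Nonempty (geo9Y x).Site]
  (C37 C38 : ∀ j : J, ℝ → CfgY 𝔸 (f j).toKIdx → AfldY 𝔸 (f j).toKIdx → Prop)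
  (par : ∀ j : J, SiteParY 𝔸 (f j).toKIdx)
  (ιB : ∀ j : J, BlkY (f j).toKIdx → IBondY (f j).toKIdx)

omit [NormOneClass 𝔸] [DecidableEq ι] instDS [∀ x : MemberY d ℓ hd hL b₀ b₁ Mstar, Nonempty (geo9Y x).Site] in
/-- the (3.42) reading dictionary of `KSC₂` is `KSC`'s (same (3.42) member). [cite: Balaban1985BackgroundPropagators, (3.42) p.397; Balaban1984PropagatorsII, (2.51) p.232] -/
theorem read342Y_KSC₂ (j : J) (hι : ∀ s : BlkY (f j).toKIdx, β (f j).toKIdx.hN (f j).toKIdx.D (f j).toKIdx.hk (ιB j s) = s)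
    (M₂ : ℝ) (hM₂ : 0 ≤ M₂) (hrepr : ∀ (v : 𝔸) (j : ι), |b.repr v j| ≤ M₂ * ‖v‖) (MInv aInv : ℝ) :
    Read342Y G (f j) (par j) b (ιB j) (C37 j) (C38 j) (KSC₂ G (f j) (par j) (C37 j) (C38 j)) c35 (M₂ * ∑ j, ‖b j‖) MInv aInv 0 True :=
  read342Y_KSC G (f j) (par j) b (ιB j) (C37 j) (C38 j) hι M₂ hM₂ hrepr c35 MInv aInv

omit [NormOneClass 𝔸] [FiniteDimensional ℝ 𝔸] [DecidableEq ι] instDS [∀ x : MemberY d ℓ hd hL b₀ b₁ Mstar, Nonempty (geo9Y x).Site] in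
/-- the (3.42) writing dictionary of `KSC₂` is `KSC`'s. [cite: Balaban1985BackgroundPropagators, (3.42) p.397, p.403; Balaban1984PropagatorsII, (2.51) p.232] -/
theorem write342Y_KSC₂ (j : J) (hι : ∀ s : BlkY (f j).toKIdx, β (f j).toKIdx.hN (f j).toKIdx.D (f j).toKIdx.hk (ιB j s) = s)
    (M₂ : ℝ) (hM₂ : 0 ≤ M₂) (hrepr : ∀ (v : 𝔸) (j : ι), |b.repr v j| ≤ M₂ * ‖v‖) (aW : ℝ) (hC37 : ∀ β' U a, C37 j β' U a → GVal G (f j).toKIdx U) :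
    Write342Y G (f j) (par j) b (ιB j) (C37 j) (C38 j) (KSC₂ G (f j) (par j) (C37 j) (C38 j)) (fun B _ => (M₂ * ∑ j, ‖b j‖) * B + 1) (fun δ => δ) aW 0 True :=
  write342Y_KSC G (f j) (par j) b (ιB j) (C37 j) (C38 j) hι M₂ hM₂ hrepr aW hC37

omit [NormOneClass 𝔸] [FiniteDimensional ℝ 𝔸] [Fintype ι] [DecidableEq ι] [∀ x : MemberY d ℓ hd hL b₀ b₁ Mstar, Fintype (geo9Y x).Site] instDS
  [∀ x : MemberY d ℓ hd hL b₀ b₁ Mstar, Nonempty (geo9Y x).Site] in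
/-- **THE SILENT GLOBAL MEMBER AT A PRODUCT SATISFIES EVERY (3.47) BLOCK WITH A NONNEGATIVE CONSTANT.** [cite: Balaban1985BackgroundPropagators, (3.47) p.398, bookkeeping] -/
theorem globBlock_KSC₂_prod (j : J) (U : CfgY 𝔸 (f j).toKIdx) (a : AfldY 𝔸 (f j).toKIdx) {B : ℝ} (hB : 0 ≤ B) :
    GlobBlock (KSC₂ G (f j) (par j) (C37 j) (C38 j)) B (.prod U a) := fun n lam γ _ _ => by
  show (0 : ℝ) ≤ B * (geo9Y (f j)).wNorm γ lam
  exact mul_nonneg hB (geo9K_wNorm_nonneg (f j).toKIdx γ lam)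

/-- ★ **THE (3.47) FRAME `GlobFrame₂` OVER THE CODED CARRIERS OF A SUBFAMILY, INHABITED** for the readings `KSC₂`: the root frame
`B9SectBCodedChainOnSubfamily.gpFrame₂CodedOn` at `KC := KSC₂` (dictionaries `read342Y_KSC₂` ∕ `write342Y_KSC₂`, reading constant `c_R = M₂Σ‖b_j‖ > 0`,
writing functions `(c_R·B + 1, δ)`) extended by `wG := 1` and the trivially true writing of the silent global member.
[cite: Balaban1985BackgroundPropagators, Thm 3.4 p.400, (3.47) p.398, (3.42) p.397, p.403; Balaban1984PropagatorsII, Lemma 2.1 p.234, (2.51) p.232] -/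
noncomputable def globFrame₂CodedOn (hι : ∀ (j : J) (s : BlkY (f j).toKIdx), β (f j).toKIdx.hN (f j).toKIdx.D (f j).toKIdx.hk (ιB j s) = s)
    (hG1 : ∀ u : 𝔸ˣ, u ∈ G → ‖(u : 𝔸)‖ ≤ 1) (hpar : ∀ j (U : CfgY 𝔸 (f j).toKIdx), GVal G (f j).toKIdx U → ∀ z w, par j U z w ∈ G)
    (hunit : ∀ j (U : CfgY 𝔸 (f j).toKIdx), GVal G (f j).toKIdx U → IsUnit (deltaPrimeAY (f j).toKIdx (par j) U))
    (dB : ℕ) (M₂ : ℝ) (hM₂ : 0 ≤ M₂) (hrepr : ∀ (v : 𝔸) (j : ι), |b.repr v j| ≤ M₂ * ‖v‖) (hcR : 0 < M₂ * ∑ j, ‖b j‖)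
    (Cq : ℝ) (hCq : 0 ≤ Cq) (hC37 : ∀ j β' U a, C37 j β' U a → GVal G (f j).toKIdx U ∧ CplxLettersY G (f j) (par j) (ιB j) Cq β' U a)
    (MInv aInv aW : ℝ) (hMInv : 0 < MInv) (haInv : 0 < aInv) (haW : 0 < aW) :
    GlobFrame₂ c35 (fun j => geo9Y (f j)) (fun j => (codingYx G (f j) (C37 j) (C38 j)).bg) (fun j => KSC₂ G (f j) (par j) (C37 j) (C38 j)) b (Fin (d + 1))
      (fun j => SiteY (f j).toKIdx) :=
  { gpFrame₂CodedOn f c35 G b C37 C38 par ιB (fun j => KSC₂ G (f j) (par j) (C37 j) (C38 j)) hι hG1 hpar hunit dB M₂ hM₂ hrepr Cq hCq hC37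
      (M₂ * ∑ j, ‖b j‖) hcR (fun B _ => (M₂ * ∑ j, ‖b j‖) * B + 1) (fun B _ hB _ => by positivity) (fun δ => δ) (fun δ hδ => hδ)
      MInv aInv aW hMInv haInv haW (fun j => read342Y_KSC₂ f c35 G b C37 C38 par ιB j (hι j) M₂ hM₂ hrepr MInv aInv)
      (fun j => write342Y_KSC₂ f G b C37 C38 par ιB j (hι j) M₂ hM₂ hrepr aW fun β' U a h => (hC37 j β' U a h).1) with
    wG := fun _ _ => 1
    wG_pos := fun _ _ _ _ => one_pos
    writeGlob := fun j c c' α₁ B δ _ _ h37 _ _ _ _ _ _ => by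
      obtain ⟨U, a, rfl, rfl, -⟩ := (codingYx G (f j) (C37 j) (C38 j)).exists_of_bg_Cplx337 h37
      exact globBlock_KSC₂_prod f G C37 C38 par j U a zero_le_one }

end Frames

/-! ## §3 ★★ `hin`, `hout` and the composed chain for `KSC₂` -/

section Chain

variable [NormOneClass 𝔸] {J : Type} (f : J → MemberY d ℓ hd hL b₀ b₁ Mstar) [∀ x : MemberY d ℓ hd hL b₀ b₁ Mstar, Fintype (geo9Y x).Site]
  (G : Subgroup 𝔸ˣ) (par : ∀ j : J, SiteParY 𝔸 (f j).toKIdx) {ι : Type} [Fintype ι] (b : Module.Basis ι ℝ 𝔸)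
  (ιB : ∀ j : J, BlkY (f j).toKIdx → IBondY (f j).toKIdx)
  (C37 C38 : ∀ j : J, ℝ → CfgY 𝔸 (f j).toKIdx → AfldY 𝔸 (f j).toKIdx → Prop)

omit [NormOneClass 𝔸] [FiniteDimensional ℝ 𝔸] in
/-- ★ **`hin` FOR `KSC₂` ON A SUBFAMILY** (at a base the blocks of `KSC₂` and `KSC` coincide: `hin_KSC_on`). [cite: Balaban1985BackgroundPropagators, Thms 3.1–3.3 (3.42)–(3.48) pp.397–399, (3.35) p.396, p.403 l.1–9; Balaban1984PropagatorsII, Lemma 2.1 (2.61) p.234] -/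
theorem hin_KSC₂_on (hι : ∀ (j : J) (s : BlkY (f j).toKIdx), β (f j).toKIdx.hN (f j).toKIdx.D (f j).toKIdx.hk (ιB j s) = s)
    (hG1 : ∀ u : 𝔸ˣ, u ∈ G → ‖(u : 𝔸)‖ ≤ 1) {M₂ : ℝ} (hM₂ : 0 ≤ M₂) (hrepr : ∀ (v : 𝔸) (j : ι), |b.repr v j| ≤ M₂ * ‖v‖) (c35 : ℝ) (dC : ℕ)
    (GA : ∀ j : J, B9.KernelFamily (geo9Y (f j)) (codingYx G (f j) (C37 j) (C38 j)).bg)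
    (Cinv : ∀ j : J, B9.SiteKernel (geo9Y (f j)) (codingYx G (f j) (C37 j) (C38 j)).bg) :
    ∀ (B₀ δ₀ : ℝ) (Bβ Bε : ℝ → ℝ) (Bεβ : ℝ → ℝ → ℝ) (B₁ δ₁ : ℝ),
      ∃ (Mi ai B₀' δ₀' : ℝ) (Bβ' Bε' : ℝ → ℝ) (Bεβ' : ℝ → ℝ → ℝ) (B₁' δ₁' : ℝ), 0 < ai ∧
        ∀ j : J, Mi ≤ (geo9Y (f j)).M → ∀ α₀ : ℝ, 0 < α₀ → (geo9Y (f j)).M * α₀ ≤ ai →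
          ∀ c : (codingYx G (f j) (C37 j) (C38 j)).bg.Cfg, (codingYx G (f j) (C37 j) (C38 j)).bg.Reg335 c35 α₀ c →
          B9.Thms31to33IneqAt dC (pullK (codingYx G (f j) (C37 j) (C38 j))
              (kernelFamilyS (f j).toKIdx (bg9Y 𝔸 G (f j)) (fun U => U) (GpY (f j).toKIdx (par j)) (par j))) (GA j) (Cinv j) B₀ δ₀ Bβ Bε Bεβ B₁ δ₁ c →
          B9.Thms31to33IneqAt dC (KSC₂ G (f j) (par j) (C37 j) (C38 j)) (GA j) (Cinv j) B₀' δ₀' Bβ' Bε' Bεβ' B₁' δ₁' c := by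
  intro B₀ δ₀ Bβ Bε Bεβ B₁ δ₁
  obtain ⟨Mi, ai, B₀', δ₀', Bβ', Bε', Bεβ', B₁', δ₁', hai, H⟩ := hin_KSC_on f G par b ιB C37 C38 hι hG1 hM₂ hrepr c35 dC GA Cinv B₀ δ₀ Bβ Bε Bεβ B₁ δ₁
  refine ⟨Mi, ai, B₀', δ₀', Bβ', Bε', Bεβ', B₁', δ₁', hai, fun j hM α₀ hα₀ hMa c hreg hT => ?_⟩
  obtain ⟨U, rfl, -⟩ := (codingYx G (f j) (C37 j) (C38 j)).exists_of_bg_Reg335 hreg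
  exact (thms_KSC₂_base_iff G (f j) (par j) (C37 j) (C38 j) dC (GA j) (Cinv j) B₀' δ₀' Bβ' Bε' Bεβ' B₁' δ₁' U).2
    (H j hM α₀ hα₀ hMa _ hreg hT)

omit [NormOneClass 𝔸] in
/-- ★★ **`hout` FOR `KSC₂` ON A SUBFAMILY, THE GLOBAL MEMBER RECOVERED AT `W = U′U`**: threshold `max Mo Mg` (`hconv_KSC_on`'s and
`globBlock_kernelFamilyS_of_eBlock`'s at the rate `δ₀/2`), caps `ao = 1`, `a′ = min a (1/4)`, constants `(max (max B₀ (B″·Cg)) B″, min δ₀ (δ₀/2), B_β, B_ε, B_εβ, B₁, δ₁)`: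
`KSC₂`'s block at the product ⟹ (e-part) the record's (3.42) block at `W` by the letter conversion ⟹ the record's (3.47) block at `W` (print p. 398) ⟹ `KSC`'s block at
the product ⟹ the record family's block read along the decoding (`thms_pullK_prod_of_KSC`).
[cite: Balaban1985BackgroundPropagators, Thm 3.4 p.400, p.403 l.1–9, (3.42) p.397, (3.47) p.398; Balaban1984PropagatorsII, Lemma 2.1 p.234] -/
theorem hout_KSC₂_on (hG1 : ∀ u : 𝔸ˣ, u ∈ G → ‖(u : 𝔸)‖ ≤ 1) {M₂ : ℝ} (hM₂ : 0 ≤ M₂) (hrepr : ∀ (v : 𝔸) (j : ι), |b.repr v j| ≤ M₂ * ‖v‖)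
    (hι : ∀ (j : J) (s : BlkY (f j).toKIdx), β (f j).toKIdx.hN (f j).toKIdx.D (f j).toKIdx.hk (ιB j s) = s)
    {Cq : ℝ} (hC37 : ∀ j β' U a, C37 j β' U a → GVal G (f j).toKIdx U ∧ CplxLettersY G (f j) (par j) (ιB j) Cq β' U a) (c35 : ℝ) (dC : ℕ)
    (GA : ∀ j : J, B9.KernelFamily (geo9Y (f j)) (codingYx G (f j) (C37 j) (C38 j)).bg)
    (Cinv : ∀ j : J, B9.SiteKernel (geo9Y (f j)) (codingYx G (f j) (C37 j) (C38 j)).bg)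
    (hGA : ∀ (j : J) (c : (codingYx G (f j) (C37 j) (C38 j)).bg.Cfg),
      (∀ lam β' ζ, 0 ≤ (GA j).h1 c lam β' ζ) ∧ (∀ lam y, 0 ≤ (GA j).e4 c lam y) ∧ (∀ lam β' ζ, 0 ≤ (GA j).h2 c lam β' ζ)) :
    ∀ (B₀ δ₀ : ℝ) (Bβ Bε : ℝ → ℝ) (Bεβ : ℝ → ℝ → ℝ) (B₁ δ₁ : ℝ) (acap : ℝ), 0 < B₀ → 0 < δ₀ → 0 < B₁ → 0 < δ₁ → 0 < acap →
      ∃ (Mo ao a' B₀' δ₀' : ℝ) (Bβ' Bε' : ℝ → ℝ) (Bεβ' : ℝ → ℝ → ℝ) (B₁' δ₁' : ℝ),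
        0 < ao ∧ 0 < a' ∧ a' ≤ acap ∧ 0 < B₀' ∧ 0 < δ₀' ∧ 0 < B₁' ∧ 0 < δ₁' ∧
        ∀ j : J, Mo ≤ (geo9Y (f j)).M → ∀ α₀ : ℝ, 0 < α₀ → (geo9Y (f j)).M * α₀ ≤ ao →
          ∀ c : (codingYx G (f j) (C37 j) (C38 j)).bg.Cfg, (codingYx G (f j) (C37 j) (C38 j)).bg.Reg335 c35 α₀ c →
          ∀ α₁ : ℝ, 0 < α₁ → α₁ ≤ a' → ∀ c' : (codingYx G (f j) (C37 j) (C38 j)).bg.Cfg, (codingYx G (f j) (C37 j) (C38 j)).bg.Cplx337 α₁ c c' →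
          B9.Thms31to33IneqAt dC (KSC₂ G (f j) (par j) (C37 j) (C38 j)) (GA j) (Cinv j) B₀ δ₀ Bβ Bε Bεβ B₁ δ₁
              ((codingYx G (f j) (C37 j) (C38 j)).bg.mul c' c) →
          B9.Thms31to33IneqAt dC (pullK (codingYx G (f j) (C37 j) (C38 j))
              (kernelFamilyS (f j).toKIdx (bg9Y 𝔸 G (f j)) (fun U => U) (GpY (f j).toKIdx (par j)) (par j))) (GA j) (Cinv j)
              B₀' δ₀' Bβ' Bε' Bεβ' B₁' δ₁' ((codingYx G (f j) (C37 j) (C38 j)).bg.mul c' c) := by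
  intro B₀ δ₀ Bβ Bε Bεβ B₁ δ₁ acap hB₀ hδ₀ hB₁ hδ₁ hacap
  obtain ⟨Mo, B'', hB'', H⟩ := hconv_KSC_on f G par b ιB C37 C38 hG1 hM₂ hrepr hι hC37 B₀ δ₀ hB₀.le hδ₀
  obtain ⟨Mg, Cg, hCg, HG⟩ := globBlock_kernelFamilyS_of_eBlock (d := d) (ℓ := ℓ) (hd := hd) (hL := hL) (b₀ := b₀) (b₁ := b₁) (Mstar := Mstar)
    (𝔸 := 𝔸) (half_pos hδ₀)
  refine ⟨max Mo Mg, 1, min acap (1 / 4), max (max B₀ (B'' * Cg)) B'', min δ₀ (δ₀ / 2), Bβ, Bε, Bεβ, B₁, δ₁, one_pos, lt_min hacap (by norm_num),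
    min_le_left _ _, lt_max_of_lt_left (lt_max_of_lt_left hB₀), lt_min hδ₀ (by linarith), hB₁, hδ₁,
    fun j hM α₀ _ _ c _ α₁ _ hα₁a c' h37 hT => ?_⟩
  obtain ⟨U, a, rfl, rfl, hC⟩ := (codingYx G (f j) (C37 j) (C38 j)).exists_of_bg_Cplx337 h37
  have hMo : Mo ≤ (geo9Y (f j)).M := le_trans (le_max_left _ _) hM
  have hMg : Mg ≤ (geo9Y (f j)).M := le_trans (le_max_right _ _) hM
  have hα₁c : α₁ ≤ 1 / 4 := le_trans hα₁a (min_le_right _ _)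
  -- the (3.42) member of `KSC₂` at the product IS `KSC`'s
  have hE : EBlock (KSC G (f j) (par j) (C37 j) (C38 j)) B₀ δ₀ (.prod U a) := hT.1.1.1
  -- the record's (3.42) block at W, then its (3.47) block at W
  have hconv := H j hMo U a α₁ hα₁c hC hE
  have hglob := HG (f j) (ιB j) (hι j) hMg (bg9Y 𝔸 G (f j)) (fun U => U) (GpY (f j).toKIdx (par j)) (par j) _ B'' hB'' hconv
  -- `KSC`'s block at the product, then the record family's
  have hK := thms_KSC_prod_of_KSC₂ G (f j) (par j) (C37 j) (C38 j) dC (GA j) (Cinv j) hB₀.le hT hglob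
  exact thms_pullK_prod_of_KSC G (f j) (par j) (C37 j) (C38 j) dC (GA j) (Cinv j) (hGA j _).1 (hGA j _).2.1 (hGA j _).2.2
    (le_max_of_le_left hB₀.le) hK hB'' hconv

omit [NormOneClass 𝔸] in
/-- ★★ **THE CODED-CARRIER CHAIN FOR `KSC₂` ON A SUBFAMILY** (as `B9SectBCodedChainOnSubfamily.sectBStepPrinted_on_of_KSC`, with `hin_KSC₂_on`, `hout_KSC₂_on`).
[cite: Balaban1985BackgroundPropagators, Thm 3.4 p.400, Sect. B pp.400–407, p.403 l.1–9, (3.35)–(3.37) p.396, (3.47) p.398, p.399] -/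
theorem sectBStepPrinted_on_of_KSC₂ (hG1 : ∀ u : 𝔸ˣ, u ∈ G → ‖(u : 𝔸)‖ ≤ 1) {M₂ : ℝ} (hM₂ : 0 ≤ M₂)
    (hrepr : ∀ (v : 𝔸) (j : ι), |b.repr v j| ≤ M₂ * ‖v‖)
    (hι : ∀ (j : J) (s : BlkY (f j).toKIdx), β (f j).toKIdx.hN (f j).toKIdx.D (f j).toKIdx.hk (ιB j s) = s)
    {Cq : ℝ} (hC37 : ∀ j β' U a, C37 j β' U a → GVal G (f j).toKIdx U ∧ CplxLettersY G (f j) (par j) (ιB j) Cq β' U a) (c35 : ℝ) (dC : ℕ)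
    (GA : ∀ j : J, B9.KernelFamily (geo9Y (f j)) (bg9Y 𝔸 G (f j))) (Cinv : ∀ j : J, B9.SiteKernel (geo9Y (f j)) (bg9Y 𝔸 G (f j)))
    (hGA : ∀ (j : J) (U : (bg9Y 𝔸 G (f j)).Cfg),
      (∀ lam β' ζ, 0 ≤ (GA j).h1 U lam β' ζ) ∧ (∀ lam y, 0 ≤ (GA j).e4 U lam y) ∧ (∀ lam β' ζ, 0 ≤ (GA j).h2 U lam β' ζ))
    (IsAnK : ∀ j : J, B9.KernelFamily (geo9Y (f j)) (codingYx G (f j) (C37 j) (C38 j)).bg → (codingYx G (f j) (C37 j) (C38 j)).bg.Cfg → ℝ → Prop)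
    (IsAn : ∀ j : J, B9.KernelFamily (geo9Y (f j)) (bg9Y 𝔸 G (f j)) → (bg9Y 𝔸 G (f j)).Cfg → ℝ → Prop)
    {r αcap Mc ac : ℝ} (hr : 0 < r) (hcap : 0 < αcap) (hac : 0 < ac)
    (hAn : ∀ (j : J) (c : (codingYx G (f j) (C37 j) (C38 j)).bg.Cfg) (α : ℝ),
      (IsAnK j (KSC₂ G (f j) (par j) (C37 j) (C38 j)) c α →
        pullAn (codingYx G (f j) (C37 j) (C38 j)) r (IsAn j)
          (pullK (codingYx G (f j) (C37 j) (C38 j)) (kernelFamilyS (f j).toKIdx (bg9Y 𝔸 G (f j)) (fun U => U) (GpY (f j).toKIdx (par j)) (par j))) c α) ∧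
      (IsAnK j (pullK (codingYx G (f j) (C37 j) (C38 j)) (GA j)) c α →
        pullAn (codingYx G (f j) (C37 j) (C38 j)) r (IsAn j) (pullK (codingYx G (f j) (C37 j) (C38 j)) (GA j)) c α))
    (hclass : ∀ (j : J) (α₀ α₁ : ℝ) (U U' : (bg9Y 𝔸 G (f j)).Cfg), Mc ≤ (geo9Y (f j)).M → 0 < α₀ → (geo9Y (f j)).M * α₀ ≤ ac →
      (bg9Y 𝔸 G (f j)).Reg335 c35 α₀ U → 0 < α₁ → α₁ ≤ αcap → (bg9Y 𝔸 G (f j)).Cplx337 α₁ U U' →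
      ∃ a : (codingYx G (f j) (C37 j) (C38 j)).A,
        (codingYx G (f j) (C37 j) (C38 j)).decA a = U' ∧ (codingYx G (f j) (C37 j) (C38 j)).C37 (r * α₁) U a)
    (h : B9.SectBStepPrinted dC c35 (fun j => geo9Y (f j)) (fun j => (codingYx G (f j) (C37 j) (C38 j)).bg)
      (fun j => KSC₂ G (f j) (par j) (C37 j) (C38 j)) (fun j => pullK (codingYx G (f j) (C37 j) (C38 j)) (GA j))
      (fun j => pullS (codingYx G (f j) (C37 j) (C38 j)) (Cinv j)) IsAnK) :
    B9.SectBStepPrinted dC c35 (fun j => geo9Y (f j)) (fun j => bg9Y 𝔸 G (f j))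
      (fun j => kernelFamilyS (f j).toKIdx (bg9Y 𝔸 G (f j)) (fun U => U) (GpY (f j).toKIdx (par j)) (par j)) GA Cinv IsAn := by
  refine sectBStepPrinted_of_coded dC c35 (fun j => geo9Y (f j)) (fun j => bg9Y 𝔸 G (f j)) (fun j => codingYx G (f j) (C37 j) (C38 j))
    (fun j => kernelFamilyS (f j).toKIdx (bg9Y 𝔸 G (f j)) (fun U => U) (GpY (f j).toKIdx (par j)) (par j)) GA Cinv IsAn hr hcap hac hclass ?_
  exact sectBStepPrinted_of_family dC c35 (fun j => geo9Y (f j)) (fun j => (codingYx G (f j) (C37 j) (C38 j)).bg)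
    (fun j => KSC₂ G (f j) (par j) (C37 j) (C38 j))
    (fun j => pullK (codingYx G (f j) (C37 j) (C38 j)) (kernelFamilyS (f j).toKIdx (bg9Y 𝔸 G (f j)) (fun U => U) (GpY (f j).toKIdx (par j)) (par j)))
    (fun j => pullK (codingYx G (f j) (C37 j) (C38 j)) (GA j)) (fun j => pullK (codingYx G (f j) (C37 j) (C38 j)) (GA j))
    (fun j => pullS (codingYx G (f j) (C37 j) (C38 j)) (Cinv j)) IsAnK
    (fun j => pullAn (codingYx G (f j) (C37 j) (C38 j)) r (IsAn j))
    (hin_KSC₂_on f G par b ιB C37 C38 hι hG1 hM₂ hrepr c35 dC _ _)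
    (hout_KSC₂_on f G par b ιB C37 C38 hG1 hM₂ hrepr hι hC37 c35 dC _ _ fun j c => hGA j _) hAn h

/-- ★★ **THE SAME WITH THE CLASS HYPOTHESES DISCHARGED** (coded class `C37Y`, transporter `parSymY`, `r = L⁴`, `αcap = 1∕4`, `Mc = 2(d+1)+1`).
[cite: Balaban1985BackgroundPropagators, Thm 3.4 p.400, Sect. B pp.400–407, (3.35)–(3.37) p.396, (3.58) p.402, (3.47) p.398] -/
theorem sectBStepPrinted_on_of_KSC₂_C37Y (hι : ∀ (j : J) (s : BlkY (f j).toKIdx), β (f j).toKIdx.hN (f j).toKIdx.D (f j).toKIdx.hk (ιB j s) = s)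
    (hG1 : ∀ u : 𝔸ˣ, u ∈ G → ‖(u : 𝔸)‖ ≤ 1) {M₂ : ℝ} (hM₂ : 0 ≤ M₂) (hrepr : ∀ (v : 𝔸) (j : ι), |b.repr v j| ≤ M₂ * ‖v‖) (c35 : ℝ) (dC : ℕ)
    (GA : ∀ j : J, B9.KernelFamily (geo9Y (f j)) (bg9Y 𝔸 G (f j))) (Cinv : ∀ j : J, B9.SiteKernel (geo9Y (f j)) (bg9Y 𝔸 G (f j)))
    (hGA : ∀ (j : J) (U : (bg9Y 𝔸 G (f j)).Cfg),
      (∀ lam β' ζ, 0 ≤ (GA j).h1 U lam β' ζ) ∧ (∀ lam y, 0 ≤ (GA j).e4 U lam y) ∧ (∀ lam β' ζ, 0 ≤ (GA j).h2 U lam β' ζ))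
    (IsAnK : ∀ j : J,
      B9.KernelFamily (geo9Y (f j)) (codingYx G (f j) (C37Y G (f j) (ιB j) (4 * ((d : ℝ) + 1) * Real.exp (3 * (((d : ℝ) + 1) / 2)))) (C38 j)).bg →
        (codingYx G (f j) (C37Y G (f j) (ιB j) (4 * ((d : ℝ) + 1) * Real.exp (3 * (((d : ℝ) + 1) / 2)))) (C38 j)).bg.Cfg → ℝ → Prop)
    (IsAn : ∀ j : J, B9.KernelFamily (geo9Y (f j)) (bg9Y 𝔸 G (f j)) → (bg9Y 𝔸 G (f j)).Cfg → ℝ → Prop) {ac : ℝ} (hac : 0 < ac)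
    (hAn : ∀ (j : J) (c : (codingYx G (f j) (C37Y G (f j) (ιB j) (4 * ((d : ℝ) + 1) * Real.exp (3 * (((d : ℝ) + 1) / 2)))) (C38 j)).bg.Cfg) (α : ℝ),
      (IsAnK j (KSC₂ G (f j) (parSymY (f j).toKIdx) (C37Y G (f j) (ιB j) (4 * ((d : ℝ) + 1) * Real.exp (3 * (((d : ℝ) + 1) / 2)))) (C38 j)) c α →
        pullAn (codingYx G (f j) (C37Y G (f j) (ιB j) (4 * ((d : ℝ) + 1) * Real.exp (3 * (((d : ℝ) + 1) / 2)))) (C38 j)) (((ℓ : ℝ) + 1) ^ 4) (IsAn j)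
          (pullK (codingYx G (f j) (C37Y G (f j) (ιB j) (4 * ((d : ℝ) + 1) * Real.exp (3 * (((d : ℝ) + 1) / 2)))) (C38 j))
            (kernelFamilyS (f j).toKIdx (bg9Y 𝔸 G (f j)) (fun U => U) (GpY (f j).toKIdx (parSymY (f j).toKIdx)) (parSymY (f j).toKIdx))) c α) ∧
      (IsAnK j (pullK (codingYx G (f j) (C37Y G (f j) (ιB j) (4 * ((d : ℝ) + 1) * Real.exp (3 * (((d : ℝ) + 1) / 2)))) (C38 j)) (GA j)) c α →
        pullAn (codingYx G (f j) (C37Y G (f j) (ιB j) (4 * ((d : ℝ) + 1) * Real.exp (3 * (((d : ℝ) + 1) / 2)))) (C38 j)) (((ℓ : ℝ) + 1) ^ 4) (IsAn j)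
          (pullK (codingYx G (f j) (C37Y G (f j) (ιB j) (4 * ((d : ℝ) + 1) * Real.exp (3 * (((d : ℝ) + 1) / 2)))) (C38 j)) (GA j)) c α))
    (h : B9.SectBStepPrinted dC c35 (fun j => geo9Y (f j))
      (fun j => (codingYx G (f j) (C37Y G (f j) (ιB j) (4 * ((d : ℝ) + 1) * Real.exp (3 * (((d : ℝ) + 1) / 2)))) (C38 j)).bg)
      (fun j => KSC₂ G (f j) (parSymY (f j).toKIdx) (C37Y G (f j) (ιB j) (4 * ((d : ℝ) + 1) * Real.exp (3 * (((d : ℝ) + 1) / 2)))) (C38 j))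
      (fun j => pullK (codingYx G (f j) (C37Y G (f j) (ιB j) (4 * ((d : ℝ) + 1) * Real.exp (3 * (((d : ℝ) + 1) / 2)))) (C38 j)) (GA j))
      (fun j => pullS (codingYx G (f j) (C37Y G (f j) (ιB j) (4 * ((d : ℝ) + 1) * Real.exp (3 * (((d : ℝ) + 1) / 2)))) (C38 j)) (Cinv j)) IsAnK) :
    B9.SectBStepPrinted dC c35 (fun j => geo9Y (f j)) (fun j => bg9Y 𝔸 G (f j))
      (fun j => kernelFamilyS (f j).toKIdx (bg9Y 𝔸 G (f j)) (fun U => U) (GpY (f j).toKIdx (parSymY (f j).toKIdx)) (parSymY (f j).toKIdx)) GA Cinv IsAn := by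
  have hL4 : (0 : ℝ) < ((ℓ : ℝ) + 1) ^ 4 := by positivity
  exact sectBStepPrinted_on_of_KSC₂ f G (fun j => parSymY (f j).toKIdx) b ιB
    (fun j => C37Y G (f j) (ιB j) (4 * ((d : ℝ) + 1) * Real.exp (3 * (((d : ℝ) + 1) / 2)))) C38 hG1 hM₂ hrepr hι
    (fun j => cplxLettersY_of_C37Y G (f j) (ιB j) _) c35 dC GA Cinv hGA IsAnK IsAn hL4 (by norm_num : (0 : ℝ) < 1 / 4) hac hAn
    (hclass_C37Y_on f G ιB C38 hι hG1 c35 ac) h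

/-- ★★ **THE SAME ON A CORNER-FREE SUBFAMILY** (`hf : β` onto at every `f j`; sections `Function.surjInv (hf j)`): no section binder, no class hypothesis.
[cite: Balaban1985BackgroundPropagators, Thm 3.4 p.400, Sect. B pp.400–407, (3.35)–(3.37) p.396, (3.47) p.398, p.399; Balaban1984PropagatorsII, (2.45) p.231] -/
theorem sectBStepPrinted_cornerFree_of_KSC₂_C37Y (hf : ∀ j : J, Function.Surjective (β (f j).toKIdx.hN (f j).toKIdx.D (f j).toKIdx.hk))
    (hG1 : ∀ u : 𝔸ˣ, u ∈ G → ‖(u : 𝔸)‖ ≤ 1) {M₂ : ℝ} (hM₂ : 0 ≤ M₂) (hrepr : ∀ (v : 𝔸) (j : ι), |b.repr v j| ≤ M₂ * ‖v‖) (c35 : ℝ) (dC : ℕ)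
    (GA : ∀ j : J, B9.KernelFamily (geo9Y (f j)) (bg9Y 𝔸 G (f j))) (Cinv : ∀ j : J, B9.SiteKernel (geo9Y (f j)) (bg9Y 𝔸 G (f j)))
    (hGA : ∀ (j : J) (U : (bg9Y 𝔸 G (f j)).Cfg),
      (∀ lam β' ζ, 0 ≤ (GA j).h1 U lam β' ζ) ∧ (∀ lam y, 0 ≤ (GA j).e4 U lam y) ∧ (∀ lam β' ζ, 0 ≤ (GA j).h2 U lam β' ζ))
    (IsAnK : ∀ j : J,
      B9.KernelFamily (geo9Y (f j))
          (codingYx G (f j) (C37Y G (f j) (fun s => Function.surjInv (hf j) s) (4 * ((d : ℝ) + 1) * Real.exp (3 * (((d : ℝ) + 1) / 2)))) (C38 j)).bg →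
        (codingYx G (f j) (C37Y G (f j) (fun s => Function.surjInv (hf j) s) (4 * ((d : ℝ) + 1) * Real.exp (3 * (((d : ℝ) + 1) / 2)))) (C38 j)).bg.Cfg →
          ℝ → Prop)
    (IsAn : ∀ j : J, B9.KernelFamily (geo9Y (f j)) (bg9Y 𝔸 G (f j)) → (bg9Y 𝔸 G (f j)).Cfg → ℝ → Prop) {ac : ℝ} (hac : 0 < ac)
    (hAn : ∀ (j : J)
      (c : (codingYx G (f j) (C37Y G (f j) (fun s => Function.surjInv (hf j) s) (4 * ((d : ℝ) + 1) * Real.exp (3 * (((d : ℝ) + 1) / 2)))) (C38 j)).bg.Cfg)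
      (α : ℝ),
      (IsAnK j (KSC₂ G (f j) (parSymY (f j).toKIdx)
          (C37Y G (f j) (fun s => Function.surjInv (hf j) s) (4 * ((d : ℝ) + 1) * Real.exp (3 * (((d : ℝ) + 1) / 2)))) (C38 j)) c α →
        pullAn (codingYx G (f j) (C37Y G (f j) (fun s => Function.surjInv (hf j) s) (4 * ((d : ℝ) + 1) * Real.exp (3 * (((d : ℝ) + 1) / 2)))) (C38 j))
          (((ℓ : ℝ) + 1) ^ 4) (IsAn j)
          (pullK (codingYx G (f j) (C37Y G (f j) (fun s => Function.surjInv (hf j) s) (4 * ((d : ℝ) + 1) * Real.exp (3 * (((d : ℝ) + 1) / 2)))) (C38 j))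
            (kernelFamilyS (f j).toKIdx (bg9Y 𝔸 G (f j)) (fun U => U) (GpY (f j).toKIdx (parSymY (f j).toKIdx)) (parSymY (f j).toKIdx))) c α) ∧
      (IsAnK j (pullK (codingYx G (f j) (C37Y G (f j) (fun s => Function.surjInv (hf j) s) (4 * ((d : ℝ) + 1) * Real.exp (3 * (((d : ℝ) + 1) / 2))))
          (C38 j)) (GA j)) c α →
        pullAn (codingYx G (f j) (C37Y G (f j) (fun s => Function.surjInv (hf j) s) (4 * ((d : ℝ) + 1) * Real.exp (3 * (((d : ℝ) + 1) / 2)))) (C38 j))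
          (((ℓ : ℝ) + 1) ^ 4) (IsAn j)
          (pullK (codingYx G (f j) (C37Y G (f j) (fun s => Function.surjInv (hf j) s) (4 * ((d : ℝ) + 1) * Real.exp (3 * (((d : ℝ) + 1) / 2)))) (C38 j))
            (GA j)) c α))
    (h : B9.SectBStepPrinted dC c35 (fun j => geo9Y (f j))
      (fun j => (codingYx G (f j) (C37Y G (f j) (fun s => Function.surjInv (hf j) s) (4 * ((d : ℝ) + 1) * Real.exp (3 * (((d : ℝ) + 1) / 2)))) (C38 j)).bg)
      (fun j => KSC₂ G (f j) (parSymY (f j).toKIdx)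
        (C37Y G (f j) (fun s => Function.surjInv (hf j) s) (4 * ((d : ℝ) + 1) * Real.exp (3 * (((d : ℝ) + 1) / 2)))) (C38 j))
      (fun j => pullK (codingYx G (f j) (C37Y G (f j) (fun s => Function.surjInv (hf j) s) (4 * ((d : ℝ) + 1) * Real.exp (3 * (((d : ℝ) + 1) / 2))))
        (C38 j)) (GA j))
      (fun j => pullS (codingYx G (f j) (C37Y G (f j) (fun s => Function.surjInv (hf j) s) (4 * ((d : ℝ) + 1) * Real.exp (3 * (((d : ℝ) + 1) / 2))))
        (C38 j)) (Cinv j)) IsAnK) :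
    B9.SectBStepPrinted dC c35 (fun j => geo9Y (f j)) (fun j => bg9Y 𝔸 G (f j))
      (fun j => kernelFamilyS (f j).toKIdx (bg9Y 𝔸 G (f j)) (fun U => U) (GpY (f j).toKIdx (parSymY (f j).toKIdx)) (parSymY (f j).toKIdx)) GA Cinv IsAn :=
  sectBStepPrinted_on_of_KSC₂_C37Y f G b (fun j s => Function.surjInv (hf j) s) C38 (fun j s => Function.surjInv_eq (hf j) s) hG1 hM₂ hrepr c35 dC GA Cinv hGA
    IsAnK IsAn hac hAn h

end Chain

end Literature.MathematicalPhysics.QuantumFieldTheory.Balaban1983to89.B9SectBCodedChainGlob
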